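/-
Copyright (c) 2026 the pub-hodgecm-mathlib formalisation cell (harness21).  Prover seat hodgecm-mathlib-K2E3-p32 (g4) (E3 hand on strike line L1; F-chain integrator of the
U1-glob TOP, road (R-eq) of RULINGS «M-160j∕k», LEAD F0P6-plan (g16) HOURLY #14), Track B «K2-LIT» ∕ hLiu418 = `stmt-HodgeConjecture-24832`: THE (base) CLAUSE OF THE (R-eq)
`_slot` CLOSER REDUCED TO THE GAUSSIAN GENERATOR.  THEOREMS ONLY (no `def`, no `instance`, no notation, no named-fact hypothesis, no `sorry`); lane `--supports
stmt-HodgeConjecture-24832 --as helper` (count-neutral).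
-/
import Summits.HodgeConjecture.HodgeConjecture.Theorems.K2LiuResidueDeadInductionLetters   -- ★ p865141 (LH7-p08 (g3)): `dead_zero`, `dead_add`, `dead_smul` at `Good := DEAD` (socket #41 BY VALUE as `h41`)
import Summits.HodgeConjecture.HodgeConjecture.Theorems.K2LiuArchGaussianOfRecord          -- ★ (LH7-p05): `archGaussianOfRecord` (`v_G`), `holCutOfRecord` (`V₀ = ℂ ∙ v_G`)
import HarnessLib

/-!
# Crux `HLiu418`, U1-glob TOP (#42F′ `slot_vanRes2E`), road (R-eq): THE (base) CLAUSE «the hol-cut domains are dead» FOLLOWS FROM «the Gaussian generators `E(v_G ⊗ f)` are dead»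

Cell `hodgecm-mathlib`, crux item hLiu418 = `stmt-HodgeConjecture-24832`; squad K2, strike line L1, LEAD F0P6-plan (g16) (HOURLY #14: «(R-eq) … by value there remains ONLY `hbase`
(scalar hol-cut surface)»); `_slot` closer K2E3-p14 (g10); generation letter ★ p865142 ∕ ★ p865190 (K2E3-p32 (g4)); DEAD-letters ★ p865141 (LH7-p08 (g3)).

THE POINT.  The `_slot` closer is `hGgen_allSignatures_of_hK₀ … (Good := DEAD) hbase dead_congr dead_zero dead_add dead_smul dead_of_hasArchDeriv` (+ ★ `resGen_eq_zero_of_dead`), and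
after the (R-eq) landslide its ONLY by-value letter besides socket #41 and the class letters is the (base) clause of ★ `hGgen`:
  «∀ V₀ finite-dimensional arch-stable with `holCutOfRecord … 𝒦 V₀` (i.e. `V₀ = ℂ ∙ v_G`, the Gaussian line of record), every `x₀ ∈ D_{V₀}` is DEAD»
(`DEAD x :⟺ ∀ P E, IsPoleClearedCont … x P E → resNorm P E = 0`, ★ p865141's inline bytes).  THIS FILE reduces it to its mathematical core — ONE family of pure-tensor generators:
  «∀ f, `E(v_G ⊗ f)` is DEAD»   (the scalar-`K_∞`-type Gaussian datum; payer: ★ F1 `resGen_eq_zero_of_presentation` at one summand + ★ p864523 §4 + the (σ-A) road's letters,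
  read on `resNorm` through ★ `dead_of_resGen_eq_zero`),
by dependent span induction on `D_{V₀} = span{E(a ⊗ f) : a ∈ ℂ ∙ v_G}`: a generator `E((c • v_G) ⊗ f) = E(v_G ⊗ (c • f))` (`TensorProduct.smul_tmul`) is a Gaussian generator, and
DEAD is closed under `0`, `+`, `•` on `D_{V₀}` by ★ p865141 `dead_zero ∕ dead_add ∕ dead_smul` (socket #41 BY VALUE as `h41`, ★ 0c's linear residue map).
* **`dead_holCut_of_gaussian (h41) (L … 𝒦 h𝒦) (hG : ∀ f P E, IsPoleClearedCont … (E(v_G ⊗ f)) P E → resNorm P E = 0) : ‹★ hGgen's (base) clause at Good := DEAD, bytes verbatim›`.**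
References: [KudlaRallis1994] S. Kudla, S. Rallis, Ann. of Math. 140 (1994) §1 Thm. 1.1; [Liu2021] Y. Liu, Camb. J. Math. 9 (2021) App. B proof of Prop. B.8 pp. 103–106 (the hol cut);
[HarrisKudlaSweet1996] §1 (1.15)–(1.17); [Folland1989] §1.7 (1.81) (the Gaussian vacuum).
HONEST LABEL.  Count-neutral helper: `HC_CM` is proved only modulo the 7 printed citations (2 remaining named inputs: hLiu418 = `stmt-HodgeConjecture-24832`,
h413 = `stmt-HodgeConjecture-24833`) until rung 0 closes; `slot_vanRes2E` stays OPEN — after this file its (base) residual is the single letter `hG` (the Gaussian generators are dead).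
-/

set_option autoImplicit false
set_option linter.dupNamespace false -- the mandated namespace repeats `HodgeConjecture.HodgeConjecture`

noncomputable section

open scoped Matrix Topology TensorProduct SchwartzMap Classical
open NumberField NumberField.mixedEmbedding IsDedekindDomain MeasureTheory Filter
open Literature.NumberTheory.Automorphic Literature.NumberTheory.Automorphic.UnitaryGroup Literature.NumberTheory.GaloisRepresentations
open Literature.NumberTheory.GelbartRogawski1991 Literature.NumberTheory.GelbartRogawski1991.GRConstruction
open Literature.NumberTheory.GelbartRogawski1991.GRConstruction.DoubledWeilDetTwist
open Literature.NumberTheory.GelbartRogawski1991.UnitaryDualPair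
open Literature.NumberTheory.K2Lit.SiegelDoubled
open Literature.NumberTheory.Automorphic.IdeleClassGroup
open Literature.NumberTheory.Automorphic.Liu2021
open Literature.NumberTheory.Automorphic.Liu2021.Def411WeilCarriers
open Literature.NumberTheory.Automorphic.Liu2021.Def411WeilCarriersDoubling
open Literature.NumberTheory.Weil1964
open Literature.RepresentationTheory.Liu2021
open Literature.RepresentationTheory.HarrisKudlaSweet1996 (IsSplittingChar)
open Summit.HodgeConjecture.HodgeConjecture.Cruxes.HLiu418.K2LiuFirstTermResidueFormDefs (resNorm)
open Summit.HodgeConjecture.HodgeConjecture.Cruxes.HLiu418.K2LiuFaceGLetterDefs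
open Summit.HodgeConjecture.HodgeConjecture.Cruxes.HLiu418.K2LiuResidueDeadInductionLetters (dead_zero dead_add dead_smul)
open Summit.HodgeConjecture.HodgeConjecture.Cruxes.HLiu418.K2LiuArchGaussianOfRecord (archGaussianOfRecord holCutOfRecord)

namespace Summit.HodgeConjecture.HodgeConjecture.Cruxes.HLiu418.K2LiuResidueDeadHolCutBase

/-- **THE (base) CLAUSE OF ★ `hGgen` AT `Good := DEAD`, FROM THE GAUSSIAN GENERATORS.**  Socket #41 BY VALUE (`h41`, ★ p865141's bytes); the #42F′ frame with a standard
Iwasawa datum `𝒦` and the det-twist equation `χ_b³·α̃ = λ̃⁻¹`; `hG`: every pure-tensor generator `E(v_G ⊗ f)` on the Gaussian line of record is DEAD.  THEN every datum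
of every hol-cut rigidity domain (`V₀ = ℂ ∙ v_G`, finite-dimensional, arch-stable) is DEAD — dependent span induction with ★ `dead_zero ∕ dead_add ∕ dead_smul`, the
generator case by `(c • v_G) ⊗ f = v_G ⊗ (c • f)`. [cite: KudlaRallis1994, §1 Thm. 1.1] [cite: Liu2021, App. B proof of Prop. B.8 pp. 103–106] [cite: Folland1989, §1.7 (1.81)] -/
theorem dead_holCut_of_gaussian
    (h41 : ∀ (L : Type) [Field L] [NumberField L] [IsCMField L] {n : ℕ} (e : Fin 2 × Fin 1 ≃ Fin n)
      (dV : Fin 2 → L) (hdV : ∀ i, IsCMField.complexConj L (dV i) = dV i) (hdV0 : ∀ i, dV i ≠ 0)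
      (dW : Fin 1 → L) (hdW : ∀ i, IsCMField.complexConj L (dW i) = dW i) (hdW0 : ∀ i, dW i ≠ 0)
      (lam : Literature.NumberTheory.Automorphic.IdeleClassGroup L →ₜ* Circle) (hlam : IsConjugateSymplectic L lam),
      HasWeight L lam 1 →
      ∀ (𝒦 : IwasawaDatum L e dV hdV dW hdW) (_h𝒦 : 𝒦.IsStd) (f : ℂ → HA L e dV hdV dW hdW → ℂ),
        IsStandardSectionFamily 𝒦 (toHeckeCharacter L lam⁻¹) f → (∀ s, Continuous (f s)) →
      ∃ (P : Finset ℂ) (Es : ℂ → HA L e dV hdV dW hdW → ℂ),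
        (∀ h : HA L e dV hdV dW hdW, DifferentiableOn ℂ (fun s => Es s h) {s : ℂ | 0 < s.re}) ∧
        (∀ s : ℂ, 0 < s.re → Continuous (Es s)) ∧
        (∀ s : ℂ, 0 < s.re → ∀ (γ : ratH L e dV hdV dW hdW) (h : HA L e dV hdV dW hdW),
          Es s ((γ : HA L e dV hdV dW hdW) * h) = Es s h) ∧
        (∀ (s : ℂ) (h : HA L e dV hdV dW hdW), (n : ℝ) / 2 < s.re →
          Es s h = (∏ p ∈ P, (s - p)) * eisensteinFamilyDelta L e dV hdV dW hdW f s h) ∧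
        (∀ z : ℂ, 0 < z.re → ∃ C A r : ℝ, 0 < r ∧ ∀ s : ℂ, dist s z < r → ∀ h : HA L e dV hdV dW hdW,
          ‖Es s h‖ ≤ C * adelicHeightGL (n + n) L (h : GL (Fin (n + n)) (AdeleRing (𝓞 L) L)) ^ A))
    (L : Type) [Field L] [NumberField L] [IsCMField L] {n : ℕ} (e : Fin 2 × Fin 1 ≃ Fin n)
    (dV : Fin 2 → L) (hdV : ∀ i, IsCMField.complexConj L (dV i) = dV i) (hdV0 : ∀ i, dV i ≠ 0)
    (dW : Fin 1 → L) (hdW : ∀ i, IsCMField.complexConj L (dW i) = dW i) (hdW0 : ∀ i, dW i ≠ 0)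
    (lam : Literature.NumberTheory.Automorphic.IdeleClassGroup L →ₜ* Circle) (hlam : IsConjugateSymplectic L lam) (hwt : HasWeight L lam 1)
    {M' n' : ℕ} (eW : Fin 1 × Fin 3 ≃ Fin M') (e' : Fin 2 × Fin M' ≃ Fin n')
    (dV' : Fin 3 → L) (hdV' : ∀ k, IsCMField.complexConj L (dV' k) = dV' k) (hdV'0 : ∀ k, dV' k ≠ 0)
    (χb : HeckeCharacter L) (hχbu : χb.IsUnitary) (hχbs : Literature.RepresentationTheory.HarrisKudlaSweet1996.IsSplittingChar L 1 χb)
    (α : UnitaryGroup.adelicOne (Fp L) L (IsCMField.complexConj L) →* ℂˣ) (hα : Continuous α)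
    (hαrat : ∀ u : UnitaryGroup.adelicOne (Fp L) L (IsCMField.complexConj L),
      (u : Literature.NumberTheory.GaloisRepresentations.ideleGroup L) ∈ Literature.NumberTheory.GaloisRepresentations.principalIdeles L → α u = 1)
    (hχD : χb ^ 3 * DoubledWeilDetTwist.ratioHecke L α hα hαrat = toHeckeCharacter L lam⁻¹)
    (𝒦 : IwasawaDatum L e dV hdV dW hdW) (h𝒦 : 𝒦.IsStd)
    -- THE ONE LETTER: the Gaussian generators are dead
    (hG : ∀ (f : FinSB (Fp L) (Fin (n' + n'))) (P : Finset ℂ) (E : ℂ → HA L e dV hdV dW hdW → ℂ),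
      IsPoleClearedCont L e dV hdV hdV0 dW hdW hdW0 eW e' dV' hdV' hdV'0 χb hχbu hχbs α 𝒦
        (piSchwartzBruhatEquiv (Fp L) (Fin (n' + n')) (archGaussianOfRecord L dV hdV hdV0 dW hdW hdW0 eW e' dV' hdV' hdV'0 ⊗ₜ[ℂ] f)) P E →
      resNorm P E = 0) :
    ∀ (V₀ : Submodule ℂ 𝓢(((Fin (n' + n')) → mixedSpace (Fp L)), ℂ)), FiniteDimensional ℂ V₀ →
      IsArchStable L e dV hdV hdV0 dW hdW hdW0 eW e' dV' hdV' hdV'0 χb hχbu hχbs 𝒦 V₀ →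
      holCutOfRecord L e dV hdV hdV0 dW hdW hdW0 lam hlam eW e' dV' hdV' hdV'0 χb hχbu hχbs α hα hαrat 𝒦 V₀ →
      ∀ x₀ : ↥(Submodule.span ℂ {x : piSchwartzBruhat (Fp L) (Fin (n' + n')) |
          ∃ a ∈ V₀, ∃ f : FinSB (Fp L) (Fin (n' + n')), x = piSchwartzBruhatEquiv (Fp L) (Fin (n' + n')) (a ⊗ₜ[ℂ] f)}),
      ∀ (P : Finset ℂ) (E : ℂ → HA L e dV hdV dW hdW → ℂ),
        IsPoleClearedCont L e dV hdV hdV0 dW hdW hdW0 eW e' dV' hdV' hdV'0 χb hχbu hχbs α 𝒦 (x₀ : piSchwartzBruhat (Fp L) (Fin (n' + n'))) P E → resNorm P E = 0 := by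
  intro V₀ hfd harch hHL x₀
  -- the hol cut of record: `V₀ = ℂ ∙ v_G`
  have hV : V₀ = ℂ ∙ archGaussianOfRecord L dV hdV hdV0 dW hdW hdW0 eW e' dV' hdV' hdV'0 := hHL
  -- dependent span induction on `x₀ ∈ D_{V₀}`
  refine Submodule.span_induction (p := fun y _ => ∀ (P : Finset ℂ) (E : ℂ → HA L e dV hdV dW hdW → ℂ),
      IsPoleClearedCont L e dV hdV hdV0 dW hdW hdW0 eW e' dV' hdV' hdV'0 χb hχbu hχbs α 𝒦 y P E → resNorm P E = 0) ?_ ?_ ?_ ?_ x₀.2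
  · -- generators: `E(a ⊗ f)` with `a = c • v_G`, and `(c • v_G) ⊗ f = v_G ⊗ (c • f)`
    rintro _ ⟨a, ha, f, rfl⟩
    rw [hV] at ha
    obtain ⟨c, rfl⟩ := Submodule.mem_span_singleton.1 ha
    rw [TensorProduct.smul_tmul]
    exact hG (c • f)
  · -- zero
    exact dead_zero h41 L e dV hdV hdV0 dW hdW hdW0 lam hlam hwt eW e' dV' hdV' hdV'0 χb hχbu hχbs α hα hαrat hχD 𝒦 h𝒦 V₀ hfd harch
  · -- add
    intro y z hy hz hGy hGz
    exact dead_add h41 L e dV hdV hdV0 dW hdW hdW0 lam hlam hwt eW e' dV' hdV' hdV'0 χb hχbu hχbs α hα hαrat hχD 𝒦 h𝒦 V₀ hfd harch ⟨y, hy⟩ ⟨z, hz⟩ hGy hGz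
  · -- smul
    intro c y hy hGy
    exact dead_smul h41 L e dV hdV hdV0 dW hdW hdW0 lam hlam hwt eW e' dV' hdV' hdV'0 χb hχbu hχbs α hα hαrat hχD 𝒦 h𝒦 V₀ hfd harch c ⟨y, hy⟩ hGy

end Summit.HodgeConjecture.HodgeConjecture.Cruxes.HLiu418.K2LiuResidueDeadHolCutBase

end
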